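import Summits.HodgeConjecture.CorCM.IrreducibleOddWeightsOrbitBalanceCMFields
import Summits.HodgeConjecture.CorCM.IrreducibleOddWeightsHodgeGluing
import Summits.HodgeConjecture.CorCM.CMAbelianVarietyDimLeThreePowers
import HarnessLib

/-!
# ORBIT BALANCE on abelian varieties: Galois pivots give `Hg(∏ A_i) = ∏ Hg(A_i)`, hence NO MIXED exceptional Hodge
# classes and Hodge gluing — e.g. `Hg(A × E_k) = Hg(A) × Hg(E_k)` whenever the type of `A` has signature defect zero on `k`

COR-CM (cell `pub-hodgecm2`, binder seat `b16` gen 62, count-neutral claim ORBIT BALANCE, file O4 — realisations;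
theorems only, no definition, no named fact, no `sorry`).  NEW as stated, hence under `Summits/`.  HONEST FRAMING:
unconditional statements about Hodge classes on products of CM abelian varieties (product span) and CONDITIONAL Hodge
gluing (the Hodge conjecture for powers of the members ⟹ for all products of copies); in §3 the gluing is UNCONDITIONAL
because the members have dimension `≤ 3`.  `HC_CM` is neither used nor asserted.

INPUT (files O1–O3): for CM fields `K_i` with types `Φ_i` and realisations `A_i ⊨ (K_i; Φ_i)`, a GALOIS PIVOT on a slot
`i` towards a slot `j` is a normal number field `M` with `jM : M → K_i`, `z₀ : M → ℂ`, `L_i ∩ L_j ⊆ z₀(M)` (Galois closures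
in `ℂ`) and `Φ_i` EQUIDISTRIBUTED over `M` (`2·#{t ∈ Φ_i | t ∘ jM = z} = #{t | t ∘ jM = z}`).  Pairwise pivots give
`cmFamilyRank Φ + |I| = Σ_i cmTypeRank Φ_i + 1` (`cmFamilyRank_add_card_eq_of_pairwise_pivot`), and this seat's gen 60
(`IrreducibleOddWeightsProductSpan` G2, `IrreducibleOddWeightsHodgeGluing` G3) turns additivity into geometry:

* §1 **`hodgeClassesProductSpan_biproduct_of_pairwise_pivot`** — every rational Hodge class on
  `(⨁_j A_{π₁ j}) × (⨁_j A_{π₂ j})` (disjoint slot maps) is a `ℂ`-combination of exterior products of rational Hodge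
  classes of the two factors: NO MIXED EXCEPTIONAL CLASSES across the family (unconditional; the members may be
  degenerate — an equidistributed type IS degenerate); **`hodgeConjectureFor_biproduct_of_pairwise_pivot_of_powSucc`** —
  the Hodge conjecture for the powers `A_i^{N+1}` of the members implies it for every product of copies `⨁_k A_{π k}`.
* §2 the PAIR forms at the reflex level (`…_of_fixingFields_inf_le_pivot`): fields of definition `E₀`, `E₁` with
  `E₀ ∩ E₁ ⊆ z₀(M)`.
* §3 NAMED INSTANCE — `K_{i₁}` normal of degree `≤ 6` embedded in `K_{i₀}` with `Φ_{i₀}` equidistributed over it (e.g.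
  `K_{i₁} = k` imaginary quadratic and `Φ_{i₀}` of signature defect zero on `k`: `A_{i₀}` of Weil type relative to `k`,
  `A_{i₁} = E_k`; or `K_{i₁} = ℚ(ζ₅), ℚ(ζ₇), ℚ(ζ₉)`, a biquadratic or cyclic sextic CM field):
  **`hodgeClassesProductSpan_biproduct_pair_of_shadow_eq_zero`** (every Hodge class on `A₀^a × A₁^b` is a sum of
  products, unconditionally) and **`hodgeConjectureFor_biproduct_pair_of_shadow_eq_zero_of_powSucc`** (the Hodge
  conjecture on every `A₀^a × A₁^b` follows from the Hodge conjecture for the powers of `A₀` ALONE — the powers of `A₁`,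
  of dimension `≤ 3`, are divisor-generated by Moonen–Zarhin (5.2), tree `CMAbelianVarietyDimLeThreePowers`).
  The tree had the NEGATIVE neighbours (`SharedImaginaryQuadraticCMFieldsHodge`: non-zero defect ⟹ an exceptional class
  on some `A₀^a × E^b`; `CMEllipticCurveTimesSimpleCMThreefold`, Moonen–Zarhin (0.1) (a)); this is the positive half.

## References

* [MoonenZarhin1999LowDim] B. Moonen, Yu. Zarhin, *Hodge classes on abelian varieties of low dimension*, Math. Ann.
  315 (1999), Thm. (0.1) (a), §3 (3.1), §5 (5.2).
* [Gordon1999HodgeAVSurvey] B. B. Gordon, *A survey of the Hodge conjecture for abelian varieties*, §3 Theorem (Imai,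
  Murty) with proof, 7.5–7.7, 9.4.3.
* [vanGeemen1994HodgeAV] B. van Geemen, LNM 1594 (1994), §3.5–3.7 Lemma 3.7 (p. 236).
* [Deligne1982HodgeCycles] P. Deligne, *Hodge cycles on abelian varieties*, LNM 900 (1982), I Ex. 3.7, §4 (Weil type).
* [Shimura1998] G. Shimura, *Abelian Varieties with Complex Multiplication and Modular Functions*, §8.1, §8.3.
-/

set_option autoImplicit false

noncomputable section

open scoped BigOperators Classical

open CategoryTheory CategoryTheory.Limits NumberField IntermediateField

namespace Summit.HodgeConjecture.CorCM

open Literature.NumberTheory.ComplexMultiplication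
open Literature.AlgebraicGeometry.Motives (AbelianVariety CMType)
open Literature.AlgebraicGeometry.Motives.AbelianVariety
open Literature.AlgebraicGeometry.HodgeTheory
open Literature.AlgebraicGeometry.ComplexMultiplication (IsCMTypeRealisation)
open Literature.AlgebraicGeometry.Pohlmann1968

variable {I J₁ J₂ : Type} [Fintype I] [Fintype J₁] [Fintype J₂] {K : I → Type} [∀ i, Field (K i)]
  [∀ i, NumberField (K i)] [∀ i, IsCMField (K i)] {Φ : ∀ i, CMType (K i)} {A : I → AbelianVariety ℂ}
  {ιA : ∀ i, 𝓞 (K i) →+* End (A i)} {θ : ∀ i, K i →+* Module.End ℂ (complexBetti (A i).X 1)}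

/-! ### §1 Families: pairwise Galois pivots -/

section Families

/-- **NO MIXED EXCEPTIONAL CLASSES UNDER PAIRWISE GALOIS PIVOTS.**  `A_i ⊨ (K_i; Φ_i)`; for every pair `i ≠ j` one slot
carries a normal `M ↪ K_i` with `L_i ∩ L_j ⊆ z₀(M)` over which `Φ_i` is equidistributed.  Then for DISJOINT slot maps
`π₁ : J₁ → I`, `π₂ : J₂ → I` every rational Hodge class on `(⨁_j A_{π₁ j}) × (⨁_j A_{π₂ j})` is a `ℂ`-combination of
exterior products of rational Hodge classes of the factors — unconditionally, degenerate members allowed.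
[cite: MoonenZarhin1999LowDim, §3 (3.1)] [cite: Gordon1999HodgeAVSurvey, §3 Theorem (proof) and 7.7] -/
theorem hodgeClassesProductSpan_biproduct_of_pairwise_pivot [Nonempty J₁] [Nonempty J₂]
    (hpiv : ∀ i j : I, i ≠ j →
      (∃ (M : Type) (_ : Field M) (_ : NumberField M) (_ : Normal ℚ M) (jM : M →+* K i) (z₀ : M →+* ℂ),
        (∀ z : ℂ, z ∈ normalClosure ℚ (K i) ℂ → z ∈ normalClosure ℚ (K j) ℂ → z ∈ Set.range z₀) ∧
        ∀ z : M →+* ℂ, 2 * (Finset.univ.filter fun t : K i →+* ℂ => t.comp jM = z ∧ t ∈ (Φ i).1).card =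
          (Finset.univ.filter fun t : K i →+* ℂ => t.comp jM = z).card) ∨
      (∃ (M : Type) (_ : Field M) (_ : NumberField M) (_ : Normal ℚ M) (jM : M →+* K j) (z₀ : M →+* ℂ),
        (∀ z : ℂ, z ∈ normalClosure ℚ (K j) ℂ → z ∈ normalClosure ℚ (K i) ℂ → z ∈ Set.range z₀) ∧
        ∀ z : M →+* ℂ, 2 * (Finset.univ.filter fun t : K j →+* ℂ => t.comp jM = z ∧ t ∈ (Φ j).1).card =
          (Finset.univ.filter fun t : K j →+* ℂ => t.comp jM = z).card))
    (hA : ∀ i, IsCMTypeRealisation (Φ i) (A i) (ιA i) (θ i)) (π₁ : J₁ → I) (π₂ : J₂ → I)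
    (hdisj : ∀ j₁ j₂, π₁ j₁ ≠ π₂ j₂) :
    HodgeClassesProductSpan (⨁ fun j => A (π₁ j)) (⨁ fun j => A (π₂ j)) := by
  obtain ⟨j₁⟩ := ‹Nonempty J₁›
  haveI : Nonempty I := ⟨π₁ j₁⟩
  exact hodgeClassesProductSpan_biproduct_of_cmFamilyRank_add_card_eq (cmFamilyRank_add_card_eq_of_pairwise_pivot Φ hpiv)
    hA π₁ π₂ hdisj

/-- **HODGE GLUING UNDER PAIRWISE GALOIS PIVOTS.**  Under the same hypothesis, the Hodge conjecture for the powers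
`A_i^{N+1}` of the members implies the Hodge conjecture for every product of copies `⨁_{k ∈ J} A_{π k}`.
[cite: MoonenZarhin1999LowDim, §3 (3.1)] [cite: Gordon1999HodgeAVSurvey, §3 Theorem (Imai, Murty) with proof, 7.5–7.7]
[cite: vanGeemen1994HodgeAV, §3.5–3.7 Lemma 3.7 (p. 236)] -/
theorem hodgeConjectureFor_biproduct_of_pairwise_pivot_of_powSucc
    (hpiv : ∀ i j : I, i ≠ j →
      (∃ (M : Type) (_ : Field M) (_ : NumberField M) (_ : Normal ℚ M) (jM : M →+* K i) (z₀ : M →+* ℂ),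
        (∀ z : ℂ, z ∈ normalClosure ℚ (K i) ℂ → z ∈ normalClosure ℚ (K j) ℂ → z ∈ Set.range z₀) ∧
        ∀ z : M →+* ℂ, 2 * (Finset.univ.filter fun t : K i →+* ℂ => t.comp jM = z ∧ t ∈ (Φ i).1).card =
          (Finset.univ.filter fun t : K i →+* ℂ => t.comp jM = z).card) ∨
      (∃ (M : Type) (_ : Field M) (_ : NumberField M) (_ : Normal ℚ M) (jM : M →+* K j) (z₀ : M →+* ℂ),
        (∀ z : ℂ, z ∈ normalClosure ℚ (K j) ℂ → z ∈ normalClosure ℚ (K i) ℂ → z ∈ Set.range z₀) ∧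
        ∀ z : M →+* ℂ, 2 * (Finset.univ.filter fun t : K j →+* ℂ => t.comp jM = z ∧ t ∈ (Φ j).1).card =
          (Finset.univ.filter fun t : K j →+* ℂ => t.comp jM = z).card))
    (hA : ∀ i, IsCMTypeRealisation (Φ i) (A i) (ιA i) (θ i))
    (hHC : ∀ (i : I) (N : ℕ), HodgeConjectureFor ((A i).powSucc N).dim ((A i).powSucc N).X)
    {J : Type} [Fintype J] [Nonempty J] (π : J → I) :
    HodgeConjectureFor (⨁ fun k => A (π k)).dim (⨁ fun k => A (π k)).X := by
  obtain ⟨k₀⟩ := ‹Nonempty J›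
  haveI : Nonempty I := ⟨π k₀⟩
  exact hodgeConjectureFor_biproduct_of_cmFamilyRank_add_card_eq (cmFamilyRank_add_card_eq_of_pairwise_pivot Φ hpiv)
    hA hHC π

end Families

/-! ### §2 Pairs at the reflex level: fields of definition meeting inside the pivot -/

section Pairs

variable {M : Type} [Field M] [NumberField M] [Normal ℚ M]

/-- **Pair, reflex level: no mixed exceptional classes.**  Two-slot family `{i₀, i₁}`; fields of definition `E₀`, `E₁`
(`Aut(ℂ/E_k)` stabilises `Φ_{i_k}`); a normal `M ↪ K_{i₀}` with `E₀ ∩ E₁ ⊆ z₀(M)` over which `Φ_{i₀}` is equidistributed.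
Then every rational Hodge class on `(⨁_j A_{π₁ j}) × (⨁_j A_{π₂ j})` (disjoint slot maps, i.e. on `A₀^a × A₁^b`) is a
`ℂ`-combination of exterior products of Hodge classes of the two factors.
[cite: MoonenZarhin1999LowDim, §3 (3.1)] [cite: Shimura1998, §8.3] -/
theorem hodgeClassesProductSpan_biproduct_of_fixingFields_inf_le_pivot [Nonempty J₁] [Nonempty J₂] {i₀ i₁ : I}
    (h01 : i₀ ≠ i₁) (hI : ∀ j, j = i₀ ∨ j = i₁) (E₀ E₁ : IntermediateField ℚ ℂ) [FiniteDimensional ℚ E₀]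
    [FiniteDimensional ℚ E₁]
    (hE₀ : ∀ σ : ℂ ≃+* ℂ, (∀ z : ℂ, z ∈ E₀ → σ z = z) → ∀ x : K i₀ →+* ℂ, σ • x ∈ (Φ i₀).1 ↔ x ∈ (Φ i₀).1)
    (hE₁ : ∀ σ : ℂ ≃+* ℂ, (∀ z : ℂ, z ∈ E₁ → σ z = z) → ∀ y : K i₁ →+* ℂ, σ • y ∈ (Φ i₁).1 ↔ y ∈ (Φ i₁).1)
    (jM : M →+* K i₀) (z₀ : M →+* ℂ) (hmeet : ∀ z : ℂ, z ∈ E₀ → z ∈ E₁ → z ∈ Set.range z₀)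
    (hbal : ∀ z : M →+* ℂ, 2 * (Finset.univ.filter fun t : K i₀ →+* ℂ => t.comp jM = z ∧ t ∈ (Φ i₀).1).card =
      (Finset.univ.filter fun t : K i₀ →+* ℂ => t.comp jM = z).card)
    (hA : ∀ i, IsCMTypeRealisation (Φ i) (A i) (ιA i) (θ i)) (π₁ : J₁ → I) (π₂ : J₂ → I)
    (hdisj : ∀ j₁ j₂, π₁ j₁ ≠ π₂ j₂) :
    HodgeClassesProductSpan (⨁ fun j => A (π₁ j)) (⨁ fun j => A (π₂ j)) :=
  hodgeClassesProductSpan_biproduct_of_cmFamilyRank_add_card_eq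
    (cmFamilyRank_add_card_eq_of_fixingFields_inf_le_pivot h01 hI Φ E₀ E₁ hE₀ hE₁ jM z₀ hmeet hbal) hA π₁ π₂ hdisj

/-- **Pair, reflex level: Hodge gluing** — the Hodge conjecture for the powers of `A_{i₀}` and of `A_{i₁}` gives it on
every `A₀^a × A₁^b` (every `⨁_k A_{π k}`). [cite: MoonenZarhin1999LowDim, §3 (3.1)] [cite: vanGeemen1994HodgeAV, §3.5–3.7 Lemma 3.7 (p. 236)] -/
theorem hodgeConjectureFor_biproduct_of_fixingFields_inf_le_pivot_of_powSucc {i₀ i₁ : I} (h01 : i₀ ≠ i₁)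
    (hI : ∀ j, j = i₀ ∨ j = i₁) (E₀ E₁ : IntermediateField ℚ ℂ) [FiniteDimensional ℚ E₀] [FiniteDimensional ℚ E₁]
    (hE₀ : ∀ σ : ℂ ≃+* ℂ, (∀ z : ℂ, z ∈ E₀ → σ z = z) → ∀ x : K i₀ →+* ℂ, σ • x ∈ (Φ i₀).1 ↔ x ∈ (Φ i₀).1)
    (hE₁ : ∀ σ : ℂ ≃+* ℂ, (∀ z : ℂ, z ∈ E₁ → σ z = z) → ∀ y : K i₁ →+* ℂ, σ • y ∈ (Φ i₁).1 ↔ y ∈ (Φ i₁).1)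
    (jM : M →+* K i₀) (z₀ : M →+* ℂ) (hmeet : ∀ z : ℂ, z ∈ E₀ → z ∈ E₁ → z ∈ Set.range z₀)
    (hbal : ∀ z : M →+* ℂ, 2 * (Finset.univ.filter fun t : K i₀ →+* ℂ => t.comp jM = z ∧ t ∈ (Φ i₀).1).card =
      (Finset.univ.filter fun t : K i₀ →+* ℂ => t.comp jM = z).card)
    (hA : ∀ i, IsCMTypeRealisation (Φ i) (A i) (ιA i) (θ i))
    (hHC : ∀ (i : I) (N : ℕ), HodgeConjectureFor ((A i).powSucc N).dim ((A i).powSucc N).X)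
    {J : Type} [Fintype J] [Nonempty J] (π : J → I) :
    HodgeConjectureFor (⨁ fun k => A (π k)).dim (⨁ fun k => A (π k)).X :=
  hodgeConjectureFor_biproduct_of_cmFamilyRank_add_card_eq
    (cmFamilyRank_add_card_eq_of_fixingFields_inf_le_pivot h01 hI Φ E₀ E₁ hE₀ hE₁ jM z₀ hmeet hbal) hA hHC π

end Pairs

/-! ### §3 Named instance: the partner's field is the pivot (`A × E_k` with signature defect zero, …) -/

section Named

/-- **EVERY HODGE CLASS ON `A₀^a × A₁^b` IS A SUM OF PRODUCTS when `K_{i₁}` is normal, embedded in `K_{i₀}`, and `Φ_{i₀}`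
is equidistributed over it** — whatever the type `Φ_{i₁}`.  For `K_{i₁} = k` imaginary quadratic: `A₀` ANY CM abelian
variety whose type has signature defect zero on `k ⊆ K_{A₀}` and `A₁ = E_k`; then `Hg(A₀ × E_k) = Hg(A₀) × Hg(E_k)` and the
Weil classes of `k` on `A₀^a × E_k^b` are products of Hodge classes of the factors.  (Non-zero defect: the tree's
`SharedImaginaryQuadraticCMFieldsHodge` gives an exceptional class instead.)
[cite: MoonenZarhin1999LowDim, Thm. (0.1) (a) and §3 (3.1)] [cite: Deligne1982HodgeCycles, §4] -/
theorem hodgeClassesProductSpan_biproduct_pair_of_shadow_eq_zero [Nonempty J₁] [Nonempty J₂] {i₀ i₁ : I} (h01 : i₀ ≠ i₁)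
    (hI : ∀ j, j = i₀ ∨ j = i₁) [Normal ℚ (K i₁)] (j : K i₁ →+* K i₀)
    (hbal : ∀ z : K i₁ →+* ℂ, 2 * (Finset.univ.filter fun t : K i₀ →+* ℂ => t.comp j = z ∧ t ∈ (Φ i₀).1).card =
      (Finset.univ.filter fun t : K i₀ →+* ℂ => t.comp j = z).card)
    (hA : ∀ i, IsCMTypeRealisation (Φ i) (A i) (ιA i) (θ i)) (π₁ : J₁ → I) (π₂ : J₂ → I)
    (hdisj : ∀ j₁ j₂, π₁ j₁ ≠ π₂ j₂) :
    HodgeClassesProductSpan (⨁ fun j => A (π₁ j)) (⨁ fun j => A (π₂ j)) :=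
  hodgeClassesProductSpan_biproduct_of_cmFamilyRank_add_card_eq
    (cmFamilyRank_add_card_eq_pair_of_shadow_eq_zero h01 hI Φ j hbal) hA π₁ π₂ hdisj

/-- **THE HODGE CONJECTURE ON EVERY `A₀^a × A₁^b` FROM THE POWERS OF `A₀` ALONE**, when `K_{i₁}` is normal of degree
`≤ 6`, embedded in `K_{i₀}`, and `Φ_{i₀}` is equidistributed over it: the powers of `A₁` (a CM abelian variety of
dimension `≤ 3`) are divisor-generated (Moonen–Zarhin (5.2)), and the pair glues.  For `K_{i₁} = k`: the Hodge conjecture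
for all `A₀^a × E_k^b` follows from the Hodge conjecture for the powers of a CM abelian variety `A₀` of Weil type relative
to `k` (e.g. known for `A₀` itself in dimension `4` by Markman; the powers remain the hypothesis).
[cite: MoonenZarhin1999LowDim, §3 (3.1) and §5 (5.2)] [cite: vanGeemen1994HodgeAV, §3.5–3.7 Lemma 3.7 (p. 236)] -/
theorem hodgeConjectureFor_biproduct_pair_of_shadow_eq_zero_of_powSucc {i₀ i₁ : I} (h01 : i₀ ≠ i₁)
    (hI : ∀ j, j = i₀ ∨ j = i₁) [Normal ℚ (K i₁)] (h6 : Module.finrank ℚ (K i₁) ≤ 6) (j : K i₁ →+* K i₀)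
    (hbal : ∀ z : K i₁ →+* ℂ, 2 * (Finset.univ.filter fun t : K i₀ →+* ℂ => t.comp j = z ∧ t ∈ (Φ i₀).1).card =
      (Finset.univ.filter fun t : K i₀ →+* ℂ => t.comp j = z).card)
    (hA : ∀ i, IsCMTypeRealisation (Φ i) (A i) (ιA i) (θ i))
    (hHC : ∀ N : ℕ, HodgeConjectureFor ((A i₀).powSucc N).dim ((A i₀).powSucc N).X)
    {J : Type} [Fintype J] [Nonempty J] (π : J → I) :
    HodgeConjectureFor (⨁ fun k => A (π k)).dim (⨁ fun k => A (π k)).X := by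
  refine hodgeConjectureFor_biproduct_of_cmFamilyRank_add_card_eq
    (cmFamilyRank_add_card_eq_pair_of_shadow_eq_zero h01 hI Φ j hbal) hA (fun i N => ?_) π
  rcases hI i with rfl | rfl
  · exact hHC N
  · -- `A_{i₁}` has dimension `[K_{i₁}:ℚ]/2 ≤ 3`: its powers are divisor-generated
    have hdim : (A i).dim = Module.finrank ℚ (K i) / 2 := Literature.AlgebraicGeometry.Motives.schemeDim_eq_holds (hA i).1
    exact hodgeConjectureFor_of_isDivisorGenerated _
      (isDivisorGenerated_powSucc_of_isOfCMType_of_dim_le_three (hA i).isOfCMType (by omega) N)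

end Named

end Summit.HodgeConjecture.CorCM

end
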